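import Summits.ValiantsHypothesis.ValiantsHypothesis.Theorems.TwoAdicLadderTwoIntegralNormalisationOfHalfElim
import Summits.ValiantsHypothesis.ValiantsHypothesis.Theorems.TwoAdicLadderTwoIntegralNormalisationAlgConst
import Summits.ValiantsHypothesis.ValiantsHypothesis.Theorems.TwoAdicLadderTwoIntegralNormalisationChainRingReduction

/-!
# TwoAdicLadder — crux `TwoIntegralNormalisation` (stmt-ValiantsHypothesis-5947), line `birth`:
# the crux from `1/2`-elimination ALONE (landed stubs plugged in)

`TwoAdicLadderTwoIntegralNormalisationOfHalfElim.lean` proves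
`TwoIntegralNormalisation ⟸ hA ∧ hC ∧ HalfElimGlobal` with the statements of the landed stubs
`stub_algConst` (`…AlgConst.lean`) and `stub_chainRingReduction` (`…ChainRingReduction.lean`) as
hypotheses. This file plugs the landed theorems in:

* `twoIntegralNormalisation_of_halfElimGlobal'` — **`HalfElimGlobal → TwoIntegralNormalisation`**;
* `twoIntegralNormalisation_of_halfElim'` — **(registered `stub_halfElim`) → TwoIntegralNormalisation`**.

So the crux is now, unconditionally, reduced to the (VH-implied) global form of `1/2`-elimination.
Honest framing: `stub_halfElim` / `HalfElimGlobal`, the crux and VP ≠ VNP are NOT proved here.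
-/

noncomputable section

-- the summit and the problem share the name `ValiantsHypothesis` (D-0017 single-conjunct layout)
set_option linter.dupNamespace false

namespace Summit.ValiantsHypothesis.ValiantsHypothesis.Theorems.TwoAdicLadder.TwoIntegralNormalisation

open Summit.ValiantsHypothesis.ValiantsHypothesis.Theses.TwoAdicLadder
open Literature.Computability.AlgebraicComplexity

/-- **`HalfElimGlobal → TwoIntegralNormalisation`** (landed stubs `stub_algConst`,
`stub_chainRingReduction` plugged into `twoIntegralNormalisation_of_halfElimGlobal`). [folklore] -/
theorem twoIntegralNormalisation_of_halfElimGlobal'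
    (h : (∃ a : ℕ, ∀ n : ℕ, ∃ (K : Type) (_ : Field K) (_ : NumberField K),
            complexity (perPoly (Fin n) K) ≤ n ^ a + a) →
          ∃ b : ℕ, ∀ᶠ n in Filter.atTop, ∃ (K' : Type) (_ : Field K') (_ : NumberField K')
            (P : Ideal (NumberField.RingOfIntegers K')) (_ : P.IsPrime),
            (2 : NumberField.RingOfIntegers K') ∈ P ∧
            complexity (perPoly (Fin n) (Localization.AtPrime P)) ≤ n ^ b) :
    TwoIntegralNormalisation :=
  twoIntegralNormalisation_of_halfElimGlobal stub_algConst
    (fun K _ _ P _ h2 k => stub_chainRingReduction K P h2 k) h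

/-- **The registered `stub_halfElim` alone gives the crux** (landed stubs plugged in). [folklore] -/
theorem twoIntegralNormalisation_of_halfElim'
    (h : ∃ d : ℕ, ∀ (n s : ℕ) (K : Type) [Field K] [NumberField K],
      complexity (perPoly (Fin n) K) ≤ s →
        ∃ (K' : Type) (_ : Field K') (_ : NumberField K')
          (P : Ideal (NumberField.RingOfIntegers K')) (_ : P.IsPrime),
          (2 : NumberField.RingOfIntegers K') ∈ P ∧
          complexity (perPoly (Fin n) (Localization.AtPrime P)) ≤ (s + n + 2) ^ d) :
    TwoIntegralNormalisation :=
  twoIntegralNormalisation_of_halfElimGlobal' (halfElimGlobal_of_halfElim h)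

end Summit.ValiantsHypothesis.ValiantsHypothesis.Theorems.TwoAdicLadder.TwoIntegralNormalisation

end
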